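import Summits.BirchSwinnertonDyer.Rank1Residual.Supersingular.BlindPointFlatTwo
import Literature.NumberTheory.EllipticCurves.PadicFormalLogOrder
import Literature.NumberTheory.EllipticCurves.QuadraticTwist
import Literature.NumberTheory.EllipticCurves.BSDRootNumberSmallConductorProofs
import Literature.NumberTheory.EllipticCurves.Rank1Residual.Predicates
import HarnessLib

/-!
# Sketch40 — MEMO-an §40 (v1.99) typed candidates: the BLIND FLAT VALUE at `ψ₂` on the odd-twist
# locus is the 2-adic `log²`-BSD quotient of the twist `E^{(2)}` ("blind Rubin formula at ψ₂").

Setting: `E/ℚ` (globally minimal model `W`), good supersingular at `2` (`a₂ ∈ {0, ±2}`), newform `f`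
of level `N = N_E`, Sprung pair `(L♯, L♭) = (Ls, Lf)` at `2`; `ψ₂` = the character of conductor `8`
= `16` … i.e. the point `T = ζ₂ − 1 = −2` of the open disc, which is the ONLY blind point of `L♭₂`
(`(1 1)·𝓛(−2) = 0`, tree `InterpolationFlatTwo`), and `E^{(2)} = E ⊗ χ_{ℚ(√2)}` (`W.quadraticTwist 2`),
whose root number is `w(E)·χ₈(N)`.  ODD-TWIST LOCUS: `w(E)·χ₈(N) = −1`.

* `FlatBlindShaAnAtChi8` (P-an-40A, BSD-free / Gross–Zagier side): if `r_an(E^{(2)}) = 1` then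
  `L♭₂(E)(ψ₂) ≠ 0` and `v₂(L♭₂(E)(ψ₂)) = v₂(#Ш_an(E^{(2)})) + v₂(Tam(E^{(2)})) + 2·(v₂(log_{Ê^{(2)}} P) −
  v₂([E^{(2)}(ℚ) : ℤP]))` for every non-torsion `P ∈ E^{(2)}(ℚ)` (`#Ш_an` = Miller's analytic order
  of `Ш`, tree `shaAn`; `padicLogOrd` = tree normalised `2`-adic formal-log order).
* `FlatBlindLogSquareBSDAtChi8` (P-an-40B, arithmetic side): the same with `#Ш(E^{(2)})[2^∞]`.
  40B = 40A + Miller's `BSDp W₂ 2`.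

Census (BC5 witness, `ana/census40.md`): 453/453 certified class-III rows (`N_E < 7813`, `64·N_E <
5·10⁵`, Cremona `allbsd/allgens`) satisfy 40A exactly, 35/35 precision-censored rows consistent,
0 violations; calibration `c = +1`: 335/335 (sha16 census40.tsv 1efb57ce95f142a0, blind40_join.json 1fb606c7ae1272a5).
BC7 (`HarnessLib.Audit.CruxProbe`, summit := `…Theses.ByReductionTypeAtTwo.RankOneAtTwoBigImageOddLocal`): both
`VERDICT: CLEAN` (P1/P2/P2h/P3/P5 ok; `bc/Probe40_verdicts.txt`).

Nearest print: Sprung arXiv:1211.1352 §6 (p. 20: "It is not clear how to relate the leading Taylor coefficient of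
`L_p(E,α,T)` at `T = ζ_{pⁿ} − 1` to the size of Ш in general"; Conj. 6.14 = orders only, its instance
`(2, ψ₂)` gives `L♭₂(ψ₂) ≠ 0` when `r₂ = 1`); Kurihara–Pollack 2007 (2.5)/(2.6) and Bernardi–Perrin-Riou 1993
(`p` odd, `a_p = 0`, DERIVATIVE at `T = 0`: `log_Ê((p+1)P)² = −(f′(0) − (p−1)/2·g′(0))·2p·log κ(γ)·[φω,ω]/C_p`);
Rubin 1992 (CM, Katz `L` outside the interpolation range `= log²`); Kobayashi 2013 (p-adic GZ, derivative,
`p = 2` allowed).  Here: a VALUE of ONE signed function at its BLIND finite-order character, `p = 2`, where the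
blind character is a quadratic twist — no derivative, no height pairing, all constants pinned by 453 curves.
NEAREST IN-TREE (disclosed): route `PrintCf2RubinValueTwo`, crux `RubinValueFormulaAtTwoV13` (stmt-31080; earlier
`RubinValueFormulaAtTwo` 23721 / `…V11` 24034) — the 2-adic RUBIN VALUE FORMULA for the CM anchor `cm7` and its
quadratic twists via the Katz two-variable measure at the pair point outside the interpolation range, with the SAME
exponent shape `m/2 = v₂ q + v₂ Tam − 2 v₂ #tors + 2ℓ + e_A/2` (there `‖val‖ = 2^{−m/2}`, residue table `e_A`).  The
present statements are its NON-CM, CYCLOTOMIC twin: good supersingular `E`, Sprung's one-variable `L♭₂(E)` at the wild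
quadratic character `ψ₂` (no CM, no Katz measure, no residue table: offset `0` on all 453 rows), typed over `IsSprungPair`.
SCOPE OF THE CERTIFICATE (rider §40.8): every curve of the census has `Δ(E) > 0` (two real components; the D9 label
list was built with `sign_disc = 1`), so the statements — asserted for all `E`, in TREE units — are certified on `Δ > 0`
only.  Units: on the sample the engine's layer sums equal `−θ_n^{tree}` exactly (`x⁺_PARI(0) = −2·L(E,1)/Ω_BSD` on 541/541
rank-0 curves; `plusPeriod f` = BSD period incl. `c_∞`; tree `θ_n` sums `η = ±1`), so the offsets below are tree-unit
offsets.  Pre-registered `Δ < 0` test (D-an-40d): tree-uniformity predicts the ENGINE reading `q + 2ℓ − 1` there.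
-/

noncomputable section

open scoped Classical MatrixGroups ModularForm

open WeierstrassCurve CongruenceSubgroup Literature.NumberTheory.EllipticCurves
  Literature.NumberTheory.EllipticCurves.ModularForms Literature.NumberTheory.EllipticCurves.Sprung2017
  Literature.NumberTheory.EllipticCurves.Rank1Residual
  Summit.BirchSwinnertonDyer.Rank1Residual.Supersingular
  Summit.BirchSwinnertonDyer.Rank1Residual.Supersingular.BlindLever

namespace Summit.BirchSwinnertonDyer.Cruxes.RankOneAtTwoBigImageOddLocal.BlindLogSqAN52

/-- **P-an-40A `FlatBlindShaAnAtChi8`** (MEMO-an §40, v1.99; BSD-free form). For `E/ℚ` good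
supersingular at `2` with newform `f`, Sprung pair `(Ls, Lf)` at `2`, on the odd-twist locus
`w(E)·χ₈(N_E) = −1`, and a globally minimal model `W₂` of the quadratic twist `E^{(2)}` by `ℚ(√2)`
of analytic rank `1`: the blind flat value `L♭₂(E)(ψ₂) = evalAt (−2) Lf` is non-zero and
`v₂(L♭₂(E)(ψ₂)) = v₂(#Ш_an(E^{(2)})) + v₂(∏ c_ℓ(E^{(2)})) + 2·(ord₂ log_{Ê^{(2)}}(P) − v₂ [E^{(2)}(ℚ):ℤP])`
for every point `P ∈ E^{(2)}(ℚ)` of infinite order and every embedding `ι : ℚ →+* ℚ₂`. -/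
def FlatBlindShaAnAtChi8 : Prop :=
  ∀ (W : WeierstrassCurve ℚ) [W.IsElliptic] [W.IsGloballyMinimal] [NeZero (W.conductorNorm ℤ)]
    (f : CuspForm (Gamma0 (W.conductorNorm ℤ)) 2),
    IsNewformOf W f → GoodSS W 2 →
    W.rootNumber * ZMod.χ₈ (W.conductorNorm ℤ : ZMod 8) = -1 →
    ∀ (Ls Lf : IwasawaAlgebra 2), IsSprungPair f 2 (W.frobeniusTrace 2) Ls Lf →
    ∀ (W₂ : WeierstrassCurve ℚ) [W₂.IsElliptic] [W₂.IsGloballyMinimal],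
      (∃ C : WeierstrassCurve.VariableChange ℚ, C • W.quadraticTwist 2 = W₂) →
      W₂.analyticRank = 1 →
    ∀ (q : ℚ), shaAn W₂ = (q : ℂ) →
    ∀ (ι : ℚ →+* ℚ_[2]) (P : (W₂.baseChange ℚ).toAffine.Point), ¬ IsOfFinAddOrder P →
      evalAt (-2 : ℤ_[2]) Lf ≠ 0 ∧
      ((evalAt (-2 : ℤ_[2]) Lf).valuation : ℤ) =
        padicValRat 2 q + (padicValNat 2 W₂.tamagawaProduct : ℤ) +
          2 * (padicLogOrd W₂ 2 ι P - (padicValNat 2 (AddSubgroup.zmultiples P).index : ℤ))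

/-- **P-an-40B `FlatBlindLogSquareBSDAtChi8`** (MEMO-an §40, v1.99; arithmetic form): as 40A with
`#Ш(E^{(2)})[2^∞]` (assumed finite) in place of `#Ш_an(E^{(2)})` and the Mordell–Weil rank in place of
the analytic rank.  40B follows from 40A and Miller's `BSDp W₂ 2` (plus GZK rank equality). -/
def FlatBlindLogSquareBSDAtChi8 : Prop :=
  ∀ (W : WeierstrassCurve ℚ) [W.IsElliptic] [W.IsGloballyMinimal] [NeZero (W.conductorNorm ℤ)]
    (f : CuspForm (Gamma0 (W.conductorNorm ℤ)) 2),
    IsNewformOf W f → GoodSS W 2 →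
    W.rootNumber * ZMod.χ₈ (W.conductorNorm ℤ : ZMod 8) = -1 →
    ∀ (Ls Lf : IwasawaAlgebra 2), IsSprungPair f 2 (W.frobeniusTrace 2) Ls Lf →
    ∀ (W₂ : WeierstrassCurve ℚ) [W₂.IsElliptic] [W₂.IsGloballyMinimal],
      (∃ C : WeierstrassCurve.VariableChange ℚ, C • W.quadraticTwist 2 = W₂) →
      W₂.mordellWeilRank = 1 → Finite (AddCommGroup.primaryComponent W₂.sha 2) →
    ∀ (ι : ℚ →+* ℚ_[2]) (P : (W₂.baseChange ℚ).toAffine.Point), ¬ IsOfFinAddOrder P →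
      evalAt (-2 : ℤ_[2]) Lf ≠ 0 ∧
      ((evalAt (-2 : ℤ_[2]) Lf).valuation : ℤ) =
        (padicValNat 2 (Nat.card (AddCommGroup.primaryComponent W₂.sha 2)) : ℤ) +
          (padicValNat 2 W₂.tamagawaProduct : ℤ) +
          2 * (padicLogOrd W₂ 2 ι P - (padicValNat 2 (AddSubgroup.zmultiples P).index : ℤ))

end Summit.BirchSwinnertonDyer.Cruxes.RankOneAtTwoBigImageOddLocal.BlindLogSqAN52

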